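import Mathlib
import Literature.Computability.AlgebraicComplexity.PermanentBooleanSum
import Summits.ValiantsHypothesis.ValiantsHypothesis.Theorems.BarrierLeverPartitionMinorsHitByVPHiddenStatesSecondShellNestedRows
import Summits.ValiantsHypothesis.ValiantsHypothesis.Theorems.BarrierLeverPartitionMinorsHitByVPHiddenStatesSecondShellPrescribed
import Summits.ValiantsHypothesis.ValiantsHypothesis.Theorems.BarrierLeverPartitionMinorsHitByVPHiddenStatesSecondShellCrossTemplate
import Summits.ValiantsHypothesis.ValiantsHypothesis.Theorems.BarrierLeverPartitionMinorsHitByVPHiddenStatesSecondShellChainFour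
import Summits.ValiantsHypothesis.ValiantsHypothesis.Theorems.BarrierLeverPartitionMinorsHitByVPHiddenStatesSecondShellPathReads

/-!
# Route BarrierLever — item `PartitionMinorsHitByVP` (stmt-ValiantsHypothesis-19717), line `hidden-states`:
# ★★ THE (2,4) NESTED CELL WITH BOTH EXTRA NODES INERT — `Y₁ = {p,q} ⊂ Y₂ = {p,q,v,w}`, `v, w ∈ A₁ ∩ C₁` (every `t, h`)

Helper file (`--supports stmt-ValiantsHypothesis-19717`; cell valiant-natproofs, 𝒟-side door (c), registered line
`Cruxes/PartitionMinorsHitByVP/Lines/hidden_states.lean` v8; prover seat val-np-p6 gen 18).  Closes NO item; definition-free.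

`C₁∖A₁ = {p, q}` (one attachment `x₀` at `p`), `C₂∖A₂ = {p, q, v, w}` with `v, w ∈ A₁ ∩ C₁` (attachments `f₀, f₁, f`).
Orient path 1 = (p < q) and path 2 = (v < w < p < q) with `f₀, f₁` at `v` and `f` at `w`.  The start row `C₁` of the cross minor
`D_{B − A₂ + C₁}` is `Z ∪ {v, w, p, q}`, `Z = (A₁ ∩ C₁) ∖ {v, w}`, and its FOUR movers form the chain `q → p → w → v` (`v` reads
`f₀, f₁`; `w` reads `v`, `f`; `p` reads `w` and `x₀`; `q` reads `p`).  All four movers lie outside `A₂`, so by the FOUR-MOVER CHAIN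
LEMMA (`…SecondShellChainFour.det_eq_zero_of_chain₄`) the only critical rows are the pure triples `Z ∪ {f, f₀, f₁} = Z ∪ (A₂∖C₂)`,
and `Z ∪ (A₂∖C₂) = A₂` forces `A₂ ∩ C₂ = Z`, i.e. `C₂ = C₁` — excluded.  ★★ `exists_table_secondShell_nested24Z`; also the `k = 1`
path bookkeeping `path₁_reads`, `path₁_zero`.  EXACT t = 4 CENSUS (kit j322364/j323376): shape ((2,4),2,0,2,2), 22 680 families.

HONEST LABEL: conjecture-column cell (second shell, every `t, h`); 19717 stays OPEN; nothing on crux 14610 or VP ≠ VNP.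
-/

set_option linter.dupNamespace false

namespace Summit.ValiantsHypothesis.ValiantsHypothesis.Theorems.BarrierLever.HiddenStates

open Finset

noncomputable section

namespace SecondShell

open PathTable

/-! ## Who reads whom in a `k = 1` path table -/

/-- sources in a `k = 1` path table with prescribed positions: `y₀` reads `x₀`; `y₁` reads `y₀`. -/
theorem path₁_reads {α : Type} {j j' : ℕ} (e : (Fin (1 + 1) ⊕ Fin 1) ⊕ (Fin j ⊕ Fin j') ≃ α) {y₀ y₁ x₀ : α}
    (h0 : e (Sum.inl (Sum.inl 0)) = y₀) (h1 : e (Sum.inl (Sum.inl 1)) = y₁) (hx0 : e (Sum.inl (Sum.inr 0)) = x₀) (d : α) :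
    (swapTable' e y₀ d ≠ 0 → d ≠ y₀ → d = x₀) ∧ (swapTable' e y₁ d ≠ 0 → d ≠ y₁ → d = y₀) := by
  have hsrc : ∀ (p : Fin (1 + 1)), swapTable' e (e (Sum.inl (Sum.inl p))) d ≠ 0 → d ≠ e (Sum.inl (Sum.inl p)) →
      (∃ p' : Fin (1 + 1), (p' : ℕ) + 1 = p ∧ d = e (Sum.inl (Sum.inl p'))) ∨ (lvlX 1 0 = p ∧ d = x₀) := by
    intro p hd hne
    rcases swapTable'_path_row_ne_zero e p hd hne with h' | ⟨i, hi, rfl⟩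
    · exact Or.inl h'
    · right; fin_cases i; exact ⟨hi, hx0⟩
  refine ⟨fun hd hne => ?_, fun hd hne => ?_⟩
  · rw [← h0] at hd hne
    rcases hsrc 0 hd hne with ⟨p', hp', -⟩ | ⟨-, h⟩
    · exfalso; simp at hp'
    · exact h
  · rw [← h1] at hd hne
    rcases hsrc 1 hd hne with ⟨p', hp', rfl⟩ | ⟨hl, -⟩
    · fin_cases p' <;> first | exact h0 | (exfalso; simp at hp')
    · exfalso; simp [lvlX] at hl

/-- the bottom of a `k = 1` path does not read the top. -/
theorem path₁_zero {α : Type} {j j' : ℕ} (e : (Fin (1 + 1) ⊕ Fin 1) ⊕ (Fin j ⊕ Fin j') ≃ α) {y₀ y₁ : α}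
    (h0 : e (Sum.inl (Sum.inl 0)) = y₀) (h1 : e (Sum.inl (Sum.inl 1)) = y₁) : swapTable' e y₀ y₁ = 0 := by
  rw [← h0, ← h1, swapTable'_path_path]; simp

/-! ## ★★ The (2,4) nested cell with both extra nodes in `A₁ ∩ C₁` -/

set_option maxHeartbeats 400000 in
/-- ★★ **SECOND SHELL, (2,4) NESTED CLASSES WITH `v, w ∈ A₁ ∩ C₁`, EVERY `t, h`.**  `C₁∖A₁ = {p,q}`, `C₂∖A₂ = {p,q,v,w}`,
`v, w ∈ A₁ ∩ C₁`: the class is served by a two-parameter path table. -/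
theorem exists_table_secondShell_nested24Z (h t : ℕ) (A₁ A₂ C₁ C₂ : Finset (Fin h))
    (hA₁ : A₁.card = t) (hA₂ : A₂.card = t) (hC₁ : C₁.card = t + 1) (hC₂ : C₂.card = t + 1)
    (h₁ : ¬ A₁ ⊆ C₁) (h₂ : ¬ A₂ ⊆ C₂) (hA : A₁ ≠ A₂) (hC : C₁ ≠ C₂)
    {yp yq yv yw : Fin h}
    (hY₁ : C₁ \ A₁ = {yp, yq}) (hpq : yp ≠ yq) (hY₂ : C₂ \ A₂ = {yp, yq, yv, yw}) (hpv : yp ≠ yv) (hpw : yp ≠ yw)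
    (hqv : yq ≠ yv) (hqw : yq ≠ yw) (hvw : yv ≠ yw) (hvA : yv ∈ A₁) (hvC : yv ∈ C₁) (hwA : yw ∈ A₁) (hwC : yw ∈ C₁)
    {r : ℕ} (u cols : Fin r → Finset (Fin h)) (hu : Function.Injective u)
    (hU : ∀ i, ((u i).card ≤ t ∧ u i ≠ A₁ ∧ u i ≠ A₂) ∨ u i = C₁ ∨ u i = C₂)
    (hcols : ∀ J : Finset (Fin h), J.card ≤ t → ∃ kk, cols kk = J) :
    ∃ tx : Option (Fin h) → Fin h → ℂ,
      (Matrix.of fun i kk : Fin r => ∏ a ∈ u i, (tx none a + ∑ q ∈ cols kk, tx (some q) a)).det ≠ 0 := by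
  classical
  obtain ⟨k₁, j₁, j₁', hk₁, hkj₁, a1, a2, a3, a4⟩ := swap_sizes A₁ C₁ hA₁ hC₁ h₁
  obtain ⟨k₂, j₂, j₂', hk₂, hkj₂, b1, b2, b3, b4⟩ := swap_sizes A₂ C₂ hA₂ hC₂ h₂
  have hY₁c : (C₁ \ A₁).card = 2 := by rw [hY₁, Finset.card_pair hpq]
  have hY₂c : (C₂ \ A₂).card = 4 := by
    rw [hY₂, Finset.card_insert_of_notMem (by simp [hpq, hpv, hpw]), Finset.card_insert_of_notMem (by simp [hqv, hqw]),
      Finset.card_pair hvw]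
  obtain rfl : k₁ = 1 := by omega
  obtain rfl : k₂ = 3 := by omega
  -- membership facts
  have hyp₁ : yp ∈ C₁ \ A₁ := by rw [hY₁]; simp
  have hyq₁ : yq ∈ C₁ \ A₁ := by rw [hY₁]; simp
  have hyp₂ : yp ∈ C₂ \ A₂ := by rw [hY₂]; simp
  have hyq₂ : yq ∈ C₂ \ A₂ := by rw [hY₂]; simp
  have hyv₂ : yv ∈ C₂ \ A₂ := by rw [hY₂]; simp
  have hyw₂ : yw ∈ C₂ \ A₂ := by rw [hY₂]; simp
  obtain ⟨⟨hypC₁, hypA₁⟩, ⟨hyqC₁, hyqA₁⟩⟩ := And.intro (Finset.mem_sdiff.1 hyp₁) (Finset.mem_sdiff.1 hyq₁)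
  obtain ⟨⟨hypC₂, hypA₂⟩, ⟨hyqC₂, hyqA₂⟩, ⟨hyvC₂, hyvA₂⟩, ⟨hywC₂, hywA₂⟩⟩ :=
    And.intro (Finset.mem_sdiff.1 hyp₂) (And.intro (Finset.mem_sdiff.1 hyq₂)
      (And.intro (Finset.mem_sdiff.1 hyv₂) (Finset.mem_sdiff.1 hyw₂)))
  -- attachments
  obtain ⟨x₀, hX₁⟩ := Finset.card_eq_one.1 a2
  obtain ⟨f₀, f₁, f, hf₀₁, hf₀, hf₁, hX₂⟩ := Finset.card_eq_three.1 b2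
  have hx₀ : x₀ ∈ A₁ \ C₁ := by rw [hX₁]; simp
  have hf₀X : f₀ ∈ A₂ \ C₂ := by rw [hX₂]; simp
  have hf₁X : f₁ ∈ A₂ \ C₂ := by rw [hX₂]; simp
  have hfX : f ∈ A₂ \ C₂ := by rw [hX₂]; simp
  -- transports: path 1 = (p < q), x₀ at p; path 2 = (v < w < p < q), f₀, f₁ at v, f at w
  have hmemY₁ : ∀ i, ![yp, yq] i ∈ C₁ \ A₁ := by
    intro i; fin_cases i
    · exact hyp₁
    · exact hyq₁
  have hmemX₁ : ∀ i, ![x₀] i ∈ A₁ \ C₁ := by intro i; fin_cases i; exact hx₀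
  have hmemY₂ : ∀ i, ![yv, yw, yp, yq] i ∈ C₂ \ A₂ := by
    intro i; fin_cases i
    · exact hyv₂
    · exact hyw₂
    · exact hyp₂
    · exact hyq₂
  have hmemX₂ : ∀ i, ![f₀, f₁, f] i ∈ A₂ \ C₂ := by
    intro i; fin_cases i
    · exact hf₀X
    · exact hf₁X
    · exact hfX
  have hinj1 : Function.Injective ![x₀] := fun i i' _ => by fin_cases i; fin_cases i'; rfl
  obtain ⟨e₁, m1, m2, m3, m4, hpy₁, hpx₁⟩ := exists_equiv_prescribed A₁ C₁ a1 a2 a3 a4 _ (injective_vec2 hpq) hmemY₁ _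
    hinj1 hmemX₁
  obtain ⟨e₂, n1, n2, n3, n4, hpy₂, hpx₂⟩ := exists_equiv_prescribed A₂ C₂ b1 b2 b3 b4 _
    (Literature.Computability.AlgebraicComplexity.injective_vec4 hvw hpv.symm hqv.symm hpw.symm hqw.symm hpq) hmemY₂ _
    (injective_vec3 hf₀₁ hf₀ hf₁) hmemX₂
  have he₁p : e₁ (Sum.inl (Sum.inl 0)) = yp := by rw [hpy₁]; rfl
  have he₁q : e₁ (Sum.inl (Sum.inl 1)) = yq := by rw [hpy₁]; rfl
  have he₁x : e₁ (Sum.inl (Sum.inr 0)) = x₀ := by rw [hpx₁]; rfl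
  have he₂v : e₂ (Sum.inl (Sum.inl 0)) = yv := by rw [hpy₂]; rfl
  have he₂w : e₂ (Sum.inl (Sum.inl 1)) = yw := by rw [hpy₂]; rfl
  have he₂p : e₂ (Sum.inl (Sum.inl 2)) = yp := by rw [hpy₂]; rfl
  have he₂q : e₂ (Sum.inl (Sum.inl 3)) = yq := by rw [hpy₂]; rfl
  have he₂f₀ : e₂ (Sum.inl (Sum.inr 0)) = f₀ := by rw [hpx₂]; rfl
  have he₂f₁ : e₂ (Sum.inl (Sum.inr 1)) = f₁ := by rw [hpx₂]; rfl
  have he₂f : e₂ (Sum.inl (Sum.inr 2)) = f := by rw [hpx₂]; rfl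
  refine exists_table_secondShell_of_cross h t A₁ A₂ C₁ C₂ hA₁ hA₂ hC₁ hC₂ hA hC hk₁ hkj₁ hk₂ hkj₂ e₁ m1 m2 m3 m4
    e₂ n1 n2 n3 n4 u cols hu hU hcols (Or.inr ?_)
  intro rows i₀ hrow₀ key hcolcard ε
  -- table facts
  have R₁ := fun d => path₁_reads e₁ he₁p he₁q he₁x d
  have R₂ := fun d => path₃_reads e₂ he₂v he₂w he₂p he₂q he₂f₀ he₂f₁ he₂f d
  have v₁pq := path₁_zero e₁ he₁p he₁q
  obtain ⟨v₂vw, v₂vp, v₂vq, v₂wp, v₂wq, v₂pv, v₂pq, v₂qv, v₂qw⟩ := path₃_zeros e₂ he₂v he₂w he₂p he₂q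
  have v₁v : ∀ d, swapTable' e₁ yv d = if d = yv then 1 else 0 :=
    row_unit A₁ C₁ e₁ m1 (fun h' => (Finset.mem_sdiff.1 h').2 hvA)
  have v₁w : ∀ d, swapTable' e₁ yw d = if d = yw then 1 else 0 :=
    row_unit A₁ C₁ e₁ m1 (fun h' => (Finset.mem_sdiff.1 h').2 hwA)
  have v₁pv : swapTable' e₁ yp yv = 0 := by
    by_contra h'; exact (Finset.mem_sdiff.1 hx₀).2 (((R₁ yv).1 h' hpv.symm) ▸ hvC)
  have v₁qv : swapTable' e₁ yq yv = 0 := by by_contra h'; exact hpv.symm ((R₁ yv).2 h' hqv.symm)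
  have v₁qw : swapTable' e₁ yq yw = 0 := by by_contra h'; exact hpw.symm ((R₁ yw).2 h' hqw.symm)
  have hunit : ∀ d, d ∈ A₁ \ C₁ ∨ d ∈ A₂ \ C₂ → ∀ q, swapTable' e₁ d q = (if q = d then 1 else 0) ∧
      swapTable' e₂ d q = (if q = d then 1 else 0) := by
    intro d hd q
    have hd₁ : d ∉ C₁ \ A₁ := by
      rcases hd with hd | hd
      · exact fun h' => (Finset.mem_sdiff.1 h').2 (Finset.mem_sdiff.1 hd).1
      · intro h'
        rw [hY₁] at h'
        simp only [Finset.mem_insert, Finset.mem_singleton] at h'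
        rcases h' with rfl | rfl
        · exact (Finset.mem_sdiff.1 hd).2 hypC₂
        · exact (Finset.mem_sdiff.1 hd).2 hyqC₂
    have hd₂ : d ∉ C₂ \ A₂ := by
      rcases hd with hd | hd
      · intro h'
        rw [hY₂] at h'
        simp only [Finset.mem_insert, Finset.mem_singleton] at h'
        rcases h' with rfl | rfl | rfl | rfl
        · exact (Finset.mem_sdiff.1 hd).2 hypC₁
        · exact (Finset.mem_sdiff.1 hd).2 hyqC₁
        · exact (Finset.mem_sdiff.1 hd).2 hvC
        · exact (Finset.mem_sdiff.1 hd).2 hwC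
      · exact fun h' => (Finset.mem_sdiff.1 h').2 (Finset.mem_sdiff.1 hd).1
    exact ⟨row_unit A₁ C₁ e₁ m1 hd₁ q, row_unit A₂ C₂ e₂ n1 hd₂ q⟩
  -- the combined table and what the movers read in it
  set w : Fin h → Fin h → ℂ := tab2 (fun a q => swapTable' e₁ a q - if q = a then 1 else 0)
      (fun a q => swapTable' e₂ a q - if q = a then 1 else 0) ε with hw
  have hwdef : ∀ y q, w y q = (if q = y then 1 else 0) + ε 0 * (swapTable' e₁ y q - if q = y then 1 else 0)
      + ε 1 * (swapTable' e₂ y q - if q = y then 1 else 0) := fun y q => rfl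
  have hoff : ∀ y d, d ≠ y → w y d ≠ 0 → swapTable' e₁ y d ≠ 0 ∨ swapTable' e₂ y d ≠ 0 := by
    intro y d hdy hw0
    by_contra hcon
    push Not at hcon
    apply hw0
    rw [hwdef, hcon.1, hcon.2, if_neg hdy]; ring
  have hreadv : ∀ d, d ≠ yv → w yv d ≠ 0 → d = f₀ ∨ d = f₁ := by
    intro d hd hw0
    rcases hoff yv d hd hw0 with h' | h'
    · exfalso; apply h'; rw [v₁v d, if_neg hd]
    · exact (R₂ d).1 h' hd
  have hreadw : ∀ d, d ≠ yw → w yw d ≠ 0 → d = yv ∨ d = f := by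
    intro d hd hw0
    rcases hoff yw d hd hw0 with h' | h'
    · exfalso; apply h'; rw [v₁w d, if_neg hd]
    · exact (R₂ d).2.1 h' hd
  have hreadp : ∀ d, d ≠ yp → w yp d ≠ 0 → d = x₀ ∨ d = yw := by
    intro d hd hw0
    rcases hoff yp d hd hw0 with h' | h'
    · exact Or.inl ((R₁ d).1 h' hd)
    · exact Or.inr ((R₂ d).2.2.1 h' hd)
  have hreadq : ∀ d, d ≠ yq → w yq d ≠ 0 → d = yp := by
    intro d hd hw0
    rcases hoff yq d hd hw0 with h' | h'
    · exact (R₁ d).2 h' hd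
    · exact (R₂ d).2.2.2 h' hd
  -- the inert part `Z = (A₁ ∩ C₁) ∖ {v, w}` of the start row `C₁`
  obtain ⟨Z, hZdef⟩ : ∃ Z : Finset (Fin h), Z = ((A₁ ∩ C₁).erase yv).erase yw := ⟨_, rfl⟩
  have hvZ₁ : yv ∈ A₁ ∩ C₁ := Finset.mem_inter.2 ⟨hvA, hvC⟩
  have hwZ₁ : yw ∈ (A₁ ∩ C₁).erase yv := Finset.mem_erase.2 ⟨hvw.symm, Finset.mem_inter.2 ⟨hwA, hwC⟩⟩
  have hZsub : Z ⊆ A₁ ∩ C₁ := by rw [hZdef]; exact (Finset.erase_subset _ _).trans (Finset.erase_subset _ _)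
  have hZc : Z.card + 3 = t := by
    have h2 : 1 < (A₁ ∩ C₁).card := Finset.one_lt_card.2 ⟨yv, hvZ₁, yw, Finset.mem_inter.2 ⟨hwA, hwC⟩, hvw⟩
    rw [hZdef, Finset.card_erase_of_mem hwZ₁, Finset.card_erase_of_mem hvZ₁, a3]; rw [a3] at h2; omega
  have hvZ : yv ∉ Z := by
    rw [hZdef]; exact fun h' => (Finset.notMem_erase yv _) (Finset.mem_of_mem_erase h')
  have hwZ : yw ∉ Z := by rw [hZdef]; exact Finset.notMem_erase _ _
  have hZ₁eq : A₁ ∩ C₁ = insert yv (insert yw Z) := by rw [hZdef, Finset.insert_erase hwZ₁, Finset.insert_erase hvZ₁]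
  have hyZ : ∀ y, y ∉ A₁ → y ∉ Z := fun y hy h' => hy (Finset.mem_inter.1 (hZsub h')).1
  have hpZ := hyZ yp hypA₁
  have hqZ := hyZ yq hyqA₁
  have hM4 : ∀ d, d ∉ ({yv, yw, yp, yq} : Finset (Fin h)) ↔ d ≠ yv ∧ d ≠ yw ∧ d ≠ yp ∧ d ≠ yq := by
    intro d; simp only [Finset.mem_insert, Finset.mem_singleton, not_or]
  have hexit : ∀ d, d ≠ yv → d ≠ yw → d ≠ yp → d ≠ yq → (w yv d ≠ 0 ∨ w yw d ≠ 0 ∨ w yp d ≠ 0 ∨ w yq d ≠ 0) →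
      d ∈ A₁ \ C₁ ∨ d ∈ A₂ \ C₂ := by
    intro d hdv hdw hdp hdq hread
    rcases hread with h' | h' | h' | h'
    · rcases hreadv d hdv h' with rfl | rfl
      · exact Or.inr hf₀X
      · exact Or.inr hf₁X
    · rcases hreadw d hdw h' with h | rfl
      · exact absurd h hdv
      · exact Or.inr hfX
    · rcases hreadp d hdp h' with rfl | h
      · exact Or.inl hx₀
      · exact absurd h hdw
    · exact absurd (hreadq d hdq h') hdp
  -- rows through a mover, and small rows, are present
  have hmov : ∀ S : Finset (Fin h), S.card ≤ t → (∃ y ∈ S, y ∉ A₂) → ∃ i, i ≠ i₀ ∧ rows i = S :=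
    fun S hS ⟨y, hyS, hyA⟩ => key S hS fun hSA => hyA (hSA ▸ hyS)
  have hcardT : ∀ T : Finset (Fin h), Disjoint T Z → T.card ≤ 3 → (T ∪ Z).card ≤ t := fun T hT hT3 => by
    rw [Finset.card_union_of_disjoint hT]; omega
  have hdisj3 : ∀ p q s : Fin h, p ∉ Z → q ∉ Z → s ∉ Z → Disjoint ({p, q, s} : Finset (Fin h)) Z := by
    intro p q s hp hq hs
    rw [Finset.disjoint_insert_left, Finset.disjoint_insert_left, Finset.disjoint_singleton_left]; exact ⟨hp, hq, hs⟩
  have hrow3 : ∀ p q s : Fin h, p ∉ A₂ → p ∉ Z → q ∉ Z → s ∉ Z → ∃ i, i ≠ i₀ ∧ rows i = {p, q, s} ∪ Z := by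
    intro p q s hpA hp hq hs
    exact hmov _ (hcardT _ (hdisj3 p q s hp hq hs) Finset.card_le_three) ⟨p, Finset.mem_union_left _ (by simp), hpA⟩
  refine det_eq_zero_of_chain₄ w rows cols i₀ Z hvw hpv.symm hqv.symm hpw.symm hqw.symm hpq hvZ hwZ hpZ hqZ
    ?_ ?_ ?_ ?_ ?_ ?_ ?_ ?_ ?_ ?_ ?_ ?_ ?_ ?_ ?_ ?_ ?_ ?_ ?_ ?_ ?_ ?_ ?_ ?_ ?_ ?_ ?_ ?_
  · -- unit rows on `Z`
    intro z hz q
    obtain ⟨hzA, hzC⟩ := Finset.mem_inter.1 (hZsub hz)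
    have hz₁ : z ∉ C₁ \ A₁ := fun h' => (Finset.mem_sdiff.1 h').2 hzA
    have hz₂ : z ∉ C₂ \ A₂ := by
      intro h'
      rw [hY₂] at h'
      simp only [Finset.mem_insert, Finset.mem_singleton] at h'
      rcases h' with rfl | rfl | rfl | rfl
      · exact hypA₁ hzA
      · exact hyqA₁ hzA
      · exact hvZ hz
      · exact hwZ hz
    rw [hwdef, row_unit A₁ C₁ e₁ m1 hz₁ q, row_unit A₂ C₂ e₂ n1 hz₂ q]; ring
  · rw [hwdef, swapTable'_self, swapTable'_self, if_pos rfl]; ring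
  · rw [hwdef, v₁v yw, v₂vw, if_neg hvw.symm]; ring
  · rw [hwdef, v₁v yp, v₂vp, if_neg hpv]; ring
  · rw [hwdef, v₁v yq, v₂vq, if_neg hqv]; ring
  · rw [hwdef, swapTable'_self, swapTable'_self, if_pos rfl]; ring
  · rw [hwdef, v₁w yp, v₂wp, if_neg hpw]; ring
  · rw [hwdef, v₁w yq, v₂wq, if_neg hqw]; ring
  · rw [hwdef, swapTable'_self, swapTable'_self, if_pos rfl]; ring
  · rw [hwdef, v₁pv, v₂pv, if_neg hpv.symm]; ring
  · rw [hwdef, v₁pq, v₂pq, if_neg hpq.symm]; ring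
  · rw [hwdef, swapTable'_self, swapTable'_self, if_pos rfl]; ring
  · rw [hwdef, v₁qv, v₂qv, if_neg hqv.symm]; ring
  · rw [hwdef, v₁qw, v₂qw, if_neg hqw.symm]; ring
  · -- read exits are attachments, hence unit rows
    intro d _ hdM hread q
    obtain ⟨hdv, hdw, hdp, hdq⟩ := (hM4 d).1 hdM
    have hd := hexit d hdv hdw hdp hdq hread
    rw [hwdef, (hunit d hd q).1, (hunit d hd q).2]; ring
  · -- the start row `C₁ = Z ∪ {v, w, p, q}`
    rw [hrow₀, eq_insert₂_inter hY₁, Finset.inter_comm, hZ₁eq]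
    ext x; simp only [Finset.mem_insert]; tauto
  · intro kk; rw [hZc]; exact hcolcard kk
  · -- small rows and mover rows
    intro T hTZ hT _
    rcases hT with hT2 | ⟨hTM, hT3⟩
    · refine key _ (hcardT T hTZ (by omega)) fun hEq => ?_
      have h1 := Finset.card_union_of_disjoint hTZ; rw [hEq, hA₂] at h1; omega
    · by_cases hT0 : T = ∅
      · refine key _ (hcardT T hTZ hT3) fun hEq => ?_
        have h1 := Finset.card_union_of_disjoint hTZ; rw [hEq, hA₂, hT0, Finset.card_empty] at h1; omega
      · obtain ⟨y, hy⟩ := Finset.nonempty_iff_ne_empty.2 hT0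
        refine hmov _ (hcardT T hTZ hT3) ⟨y, Finset.mem_union_left _ hy, ?_⟩
        have hyM := hTM hy
        simp only [Finset.mem_insert, Finset.mem_singleton] at hyM
        rcases hyM with rfl | rfl | rfl | rfl
        · exact hyvA₂
        · exact hywA₂
        · exact hypA₂
        · exact hyqA₂
  · intro d hdZ _ _; exact hrow3 yv yw d hyvA₂ hvZ hwZ hdZ
  · intro d hdZ _ _ _; exact hrow3 yv yp d hyvA₂ hvZ hpZ hdZ
  · intro d hdZ _ _; exact hrow3 yv yq d hyvA₂ hvZ hqZ hdZ
  · intro d hdZ _ _ _; exact hrow3 yw yp d hywA₂ hwZ hpZ hdZ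
  · intro d hdZ _ _ _; exact hrow3 yw yq d hywA₂ hwZ hqZ hdZ
  · intro d hdZ _ _; exact hrow3 yp yq d hypA₂ hpZ hqZ hdZ
  · intro d d' _ hdZ hd'Z _ _ _ _; exact hrow3 yv d d' hyvA₂ hvZ hdZ hd'Z
  · intro d d' _ hdZ hd'Z _ _ _ _; exact hrow3 yw d d' hywA₂ hwZ hdZ hd'Z
  · intro d d' _ hdZ hd'Z _ _ _ _; exact hrow3 yq d d' hyqA₂ hqZ hdZ hd'Z
  · -- ★ the pure triples are `{f, f₀, f₁} = A₂ ∖ C₂`: `Z ∪ (A₂∖C₂) = A₂` forces `C₂ ⊆ C₁`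
    intro d d' d'' _ _ hd'd'' hdZ hd'Z hd''Z hdM hd'M hd''M hwd hvd' hvd''
    obtain ⟨hdv, hdw, -, -⟩ := (hM4 d).1 hdM
    obtain ⟨hd'v, -, -, -⟩ := (hM4 d').1 hd'M
    obtain ⟨hd''v, -, -, -⟩ := (hM4 d'').1 hd''M
    refine key _ (hcardT _ (hdisj3 d d' d'' hdZ hd'Z hd''Z) Finset.card_le_three) fun hEq => ?_
    have hdf : d = f := by
      rcases hreadw d hdw hwd with h' | h'
      · exact absurd h' hdv
      · exact h'
    have hX : ∀ g, g ∈ ({d, d', d''} : Finset (Fin h)) → g ∈ A₂ \ C₂ := by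
      intro g hg
      simp only [Finset.mem_insert, Finset.mem_singleton] at hg
      rcases hg with rfl | rfl | rfl
      · exact hdf ▸ hfX
      · rcases hreadv _ hd'v hvd' with rfl | rfl
        · exact hf₀X
        · exact hf₁X
      · rcases hreadv _ hd''v hvd'' with rfl | rfl
        · exact hf₀X
        · exact hf₁X
    have hsub : C₂ ⊆ C₁ := by
      intro x hx
      by_cases hxA : x ∈ A₂
      · have hx' : x ∈ ({d, d', d''} : Finset (Fin h)) ∪ Z := by rw [hEq]; exact hxA
        rw [Finset.mem_union] at hx'
        rcases hx' with hxT | hxZ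
        · exact absurd hx (Finset.mem_sdiff.1 (hX x hxT)).2
        · exact (Finset.mem_inter.1 (hZsub hxZ)).2
      · have hxY : x ∈ C₂ \ A₂ := Finset.mem_sdiff.2 ⟨hx, hxA⟩
        rw [hY₂] at hxY
        simp only [Finset.mem_insert, Finset.mem_singleton] at hxY
        rcases hxY with rfl | rfl | rfl | rfl
        · exact hypC₁
        · exact hyqC₁
        · exact hvC
        · exact hwC
    exact hC (Finset.eq_of_subset_of_card_le hsub (by rw [hC₁, hC₂])).symm

end SecondShell

end

end Summit.ValiantsHypothesis.ValiantsHypothesis.Theorems.BarrierLever.HiddenStates
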